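import Literature.Probability.RandomPlanarGeometry.LoewnerRoomStopBounds
import Literature.Probability.RandomPlanarGeometry.LoewnerAdaptedPlane
import Mathlib.Probability.Process.Stopping
import HarnessLib

/-!
# The room stop is a stopping time and the stopped room–entropy combination is adapted

Topic `Literature/Probability/RandomPlanarGeometry`; companion of `LoewnerRoomStopBounds.lean`
(the room stop `τ^{z,m} = inf ({u | Im z_u ≤ Im z/(m+1)} ∪ {m+1})` of the centred chordal
Loewner flow `z_t = g_t(z) - W_t`, `τ < T_z`, `Im z_u ≥ Im z/(m+1)` up to `τ`) and of
`LoewnerAdaptedPlane.lean` (the flow `g_t(z)` of a point of `ℍ` is a measurable functional of the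
driving path up to time `t`: `Loewner.measurable_map_of_im_pos`,
`Loewner.measurableSet_lt_swallowingTime_of_im_pos`, and the truncated flows `truncFlowC`).

For a family of continuous driving paths `W ω : ℝ≥0 → ℝ` indexed by a measurable space
`(Ω, 𝓜)` whose values at times `≤ t` are `𝓜`-measurable (think of `𝓜 = 𝓕_t` for a filtration
to which the driving PROCESS is adapted), and a point `z` with `Im z > 0`, we prove — this is the
measure-theoretic half of "the stopped observable `N_{t ∧ τ^{z,m}}(z)` is a bounded continuous
adapted process", consumed by martingale statements about the room–entropy combination
`N_t(z) = log ψ_t(z) + 3 H(S_t(z))` (`ψ` = `Loewner.derivRatio`, `S` = `Loewner.schrammObs`):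

* `roomStop_le_iff` — the pathwise DESCRIPTION of the event `{τ^{z,m} ≤ s}`:
  `τ ≤ s ↔ m + 1 ≤ s ∨ ¬ s < T_z ∨ Im z_s ≤ Im z/(m+1)` (the height `Im z_u` is continuous and
  non-increasing on `[0, T_z)` and tends to `0` at a finite swallowing time);
* `measurableSet_roomStop_le`, **`isStoppingTime_roomStop`** — hence `{τ ≤ s}` is decided by the
  path up to time `s`, measurably: the room stop is a stopping time of every filtration to which
  the driving process is adapted (Rohde–Schramm 2005, proof of Lemma 6.3: "an increasing
  sequence of stopping times `t_n < τ(ẑ)`");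
* `measurable_min_roomStop` — `ω ↦ t ∧ τ(ω)` is `𝓜`-measurable;
* **`measurable_centredMap_min_roomStop`** — `ω ↦ z_{t ∧ τ}` is `𝓜`-measurable: up to the room
  stop the flow stays at height `≥ Im z/(m+1)`, so it IS the flow of the Loewner field truncated
  at that height (`truncFlowC`, globally Lipschitz, jointly measurable in `(ω, time)` as a
  Carathéodory function), evaluated at a measurable random time;
* `measurable_schrammObs_min_roomStop` — `ω ↦ S_{t ∧ τ}` is `𝓜`-measurable;
* **`measurable_log_derivRatio_min_roomStop`** — `ω ↦ log ψ_{t ∧ τ} = ∫₀^{t∧τ} 4y²/|z|⁴`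
  (Rohde–Schramm (6.3)) is `𝓜`-measurable: the rate along the truncated flow is jointly
  measurable and the integral of a jointly measurable integrand over the random interval
  `(0, t ∧ τ]` is measurable (Fubini measurability, `StronglyMeasurable.integral_prod_right`);
* **`measurable_roomObs_min_roomStop`**, `stronglyMeasurable_roomObs_min_roomStop` — the stopped
  room–entropy combination `ω ↦ log ψ_{t∧τ} + 3 H(S_{t∧τ})` is `𝓜`-measurable; with
  `𝓜 = 𝓕_t` this is adaptedness (`adapted_roomObs_min_roomStop`).

Everything is proved; no definition and no named fact is introduced (the expressions are those
to which the summit-side `roomStop`, `roomObsStopped` of the line `room-entropy-wright-fisher`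
unfold).

## References

* S. Rohde, O. Schramm, *Basic properties of SLE*, Ann. of Math. 161 (2005), §2.1, §3 (p. 896:
  measurability with respect to `σ(ξ(s), s ≤ t)`), proof of Lemma 6.3 (p. 905).
* D. Revuz, M. Yor, *Continuous Martingales and Brownian Motion* (1999), Ch. I §4
  (hitting times of closed sets by continuous adapted processes; progressive measurability).
-/

noncomputable section

open Set Filter Topology Metric MeasureTheory Complex
open scoped NNReal

namespace Literature.Probability.RandomPlanarGeometry

namespace Loewner

/-! ### Pathwise description of the event `{τ ≤ s}` -/

section Pathwise

variable {W : ℝ≥0 → ℝ} {z : ℂ}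

/-- Monotonicity of the height of the centred flow: `Im z_s ≤ Im z_u` for `u ≤ s < T_z`.
[folklore] -/
theorem im_centredMap_antitone (hW : Continuous W) (hz : 0 < z.im) {u s : ℝ≥0} (hus : u ≤ s)
    (hs : (s : WithTop ℝ≥0) < swallowingTime W z) :
    (centredMap W s z).im ≤ (centredMap W u z).im := by
  have hzW : z ≠ W 0 := ne_driving_of_im_pos hz 0
  obtain ⟨g, hg⟩ := exists_isSolution_swallowingTime_holds hW hzW
  have hu : (u : WithTop ℝ≥0) < swallowingTime W z := lt_of_le_of_lt (WithTop.coe_le_coe.2 hus) hs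
  obtain ⟨-, hmono⟩ := im_apply_le_im_of_le hW hg hz hs
  have h1 := hmono u ⟨u.coe_nonneg, NNReal.coe_le_coe.2 hus⟩
  rw [centredMap_eq_of_isSolution hW hg hs, centredMap_eq_of_isSolution hW hg hu,
    Complex.sub_im, Complex.sub_im, Complex.ofReal_im, Complex.ofReal_im, sub_zero, sub_zero]
  exact h1

/-- **Pathwise description of `{τ^{z,m} ≤ s}`** (`W` continuous, `Im z > 0`): the room stop has
occurred by time `s` iff the cap is reached (`m + 1 ≤ s`), or `z` is swallowed by time `s`
(`¬ s < T_z`; then the height has dropped to `0`, hence below the level, strictly before), or the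
flow is alive at `s` with height `≤ Im z/(m+1)` (the height being non-increasing). [folklore] -/
theorem roomStop_le_iff (hW : Continuous W) (hz : 0 < z.im) (m : ℕ) (s : ℝ≥0) :
    sInf ({u : ℝ≥0 | (centredMap W u z).im ≤ z.im / ((m : ℝ) + 1)} ∪ {(m : ℝ≥0) + 1}) ≤ s ↔
      (m : ℝ≥0) + 1 ≤ s ∨ ¬ (s : WithTop ℝ≥0) < swallowingTime W z ∨
        (centredMap W s z).im ≤ z.im / ((m : ℝ) + 1) := by
  set S := {u : ℝ≥0 | (centredMap W u z).im ≤ z.im / ((m : ℝ) + 1)} ∪ {(m : ℝ≥0) + 1} with hS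
  set L := z.im / ((m : ℝ) + 1) with hL
  have hbdd : BddBelow S := OrderBot.bddBelow S
  constructor
  · intro hτ
    by_contra hcon
    simp only [not_or, not_le, not_not] at hcon
    obtain ⟨hcap, hsT, hYs⟩ := hcon
    -- a time `s₁ ∈ (s, T_z)` at which the height is still above the level
    have hzW : z ≠ W 0 := ne_driving_of_im_pos hz 0
    set D := {u : ℝ≥0 | (u : WithTop ℝ≥0) < swallowingTime W z} with hD
    have hc : ContinuousWithinAt (fun u : ℝ≥0 ↦ (centredMap W u z).im) D s :=
      Complex.continuous_im.continuousAt.comp_continuousWithinAt ((continuousOn_centredMap hW hzW) s hsT)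
    have hev : ∀ᶠ u in 𝓝[D] s, L < (centredMap W u z).im := hc (Ioi_mem_nhds hYs)
    -- `(s, s₂) ⊆ D ∩ (s, ∞)` for some `s₂ > s`
    obtain ⟨s₂, hs₂, hsub⟩ : ∃ s₂ : ℝ≥0, s < s₂ ∧ Ioo s s₂ ⊆ D ∩ Ioi s := by
      cases hT : swallowingTime W z with
      | top =>
        refine ⟨s + 1, lt_add_one s, fun u hu ↦ ⟨?_, hu.1⟩⟩
        show (u : WithTop ℝ≥0) < swallowingTime W z
        rw [hT]; exact WithTop.coe_lt_top u
      | coe b =>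
        have hsb : s < b := by rw [hT] at hsT; exact WithTop.coe_lt_coe.1 hsT
        refine ⟨b, hsb, fun u hu ↦ ⟨?_, hu.1⟩⟩
        show (u : WithTop ℝ≥0) < swallowingTime W z
        rw [hT]; exact WithTop.coe_lt_coe.2 hu.2
    have hne : (𝓝[D ∩ Ioi s] s).NeBot := by
      refine mem_closure_iff_nhdsWithin_neBot.1 (closure_mono hsub ?_)
      rw [closure_Ioo hs₂.ne]
      exact left_mem_Icc.2 hs₂.le
    have hev' : ∀ᶠ u in 𝓝[D ∩ Ioi s] s, L < (centredMap W u z).im :=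
      nhdsWithin_mono s inter_subset_left hev
    obtain ⟨s₁, hYs₁, hs₁D, hss₁⟩ := (hev'.and self_mem_nhdsWithin).exists
    -- every element of `S` exceeds `min s₁ (m+1) > s`
    have hlow : ∀ a ∈ S, min s₁ ((m : ℝ≥0) + 1) ≤ a := by
      rintro a (ha | ha)
      · refine (min_le_left _ _).trans (not_lt.1 fun has₁ ↦ ?_)
        have haT : (s₁ : WithTop ℝ≥0) < swallowingTime W z := hs₁D
        have hmono := im_centredMap_antitone hW hz has₁.le haT
        exact absurd (hYs₁.trans_le hmono) (not_lt.2 ha)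
      · rw [mem_singleton_iff] at ha
        rw [ha]
        exact min_le_right _ _
    have hτlow : min s₁ ((m : ℝ≥0) + 1) ≤ sInf S := le_csInf ⟨(m : ℝ≥0) + 1, Or.inr rfl⟩ hlow
    have hslt : s < min s₁ ((m : ℝ≥0) + 1) := lt_min hss₁ hcap
    exact lt_irrefl _ ((hslt.trans_le hτlow).trans_le hτ)
  · rintro (hcap | hsT | hYs)
    · exact (csInf_le hbdd (Or.inr rfl)).trans hcap
    · -- swallowed by time `s`: the height drops below the level strictly before `T_z ≤ s`
      cases hT : swallowingTime W z with
      | top => rw [hT] at hsT; exact absurd (WithTop.coe_lt_top s) hsT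
      | coe b =>
        have hε : 0 < L := by positivity
        obtain ⟨t₀, ht₀T, ht₀⟩ := exists_forall_im_centredMap_lt hW hz hT hε
        have hlt := ht₀ t₀ le_rfl ht₀T
        rw [hT] at ht₀T hsT
        have ht₀b : t₀ < b := WithTop.coe_lt_coe.1 ht₀T
        have hbs : b ≤ s := not_lt.1 fun h ↦ hsT (WithTop.coe_lt_coe.2 h)
        exact ((csInf_le hbdd (Or.inl hlt.le)).trans ht₀b.le).trans hbs
    · exact csInf_le hbdd (Or.inl hYs)

end Pathwise

/-! ### Measurability: the room stop is a stopping time -/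

section Measurable

variable {Ω : Type*} {mΩ : MeasurableSpace Ω} {W : Ω → ℝ≥0 → ℝ} {t : ℝ≥0} {z : ℂ}

/-- The centred flow at a time `s ≤ t` is measurable in `ω` when the path values at times `≤ t`
are (`measurable_map_of_im_pos`). [folklore] -/
theorem measurable_centredMap_of_im_pos (hc : ∀ ω, Continuous (W ω))
    (hmeas : ∀ s, s ≤ t → Measurable fun ω ↦ W ω s) (hz : 0 < z.im) {s : ℝ≥0} (hs : s ≤ t) :
    Measurable fun ω ↦ centredMap (W ω) s z := by
  have h1 : Measurable fun ω ↦ map (W ω) s z :=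
    measurable_map_of_im_pos hc (fun u hu ↦ hmeas u (hu.trans hs)) hz
  exact h1.sub (Complex.measurable_ofReal.comp (hmeas s hs))

/-- **`{τ^{z,m} ≤ s}` is measurable** with respect to any σ-algebra making the path values at
times `≤ s` measurable (continuous paths, `Im z > 0`), by `roomStop_le_iff`. [folklore] -/
theorem measurableSet_roomStop_le (hc : ∀ ω, Continuous (W ω))
    (hmeas : ∀ s, s ≤ t → Measurable fun ω ↦ W ω s) (hz : 0 < z.im) (m : ℕ) {s : ℝ≥0}
    (hs : s ≤ t) :
    MeasurableSet {ω | sInf ({u : ℝ≥0 | (centredMap (W ω) u z).im ≤ z.im / ((m : ℝ) + 1)} ∪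
      {(m : ℝ≥0) + 1}) ≤ s} := by
  have hset : {ω | sInf ({u : ℝ≥0 | (centredMap (W ω) u z).im ≤ z.im / ((m : ℝ) + 1)} ∪
      {(m : ℝ≥0) + 1}) ≤ s} =
      {ω | (m : ℝ≥0) + 1 ≤ s} ∪ ({ω | (s : WithTop ℝ≥0) < swallowingTime (W ω) z}ᶜ ∪
        {ω | (centredMap (W ω) s z).im ≤ z.im / ((m : ℝ) + 1)}) := by
    ext ω
    simp only [mem_setOf_eq, mem_union, mem_compl_iff]
    rw [roomStop_le_iff (hc ω) hz m s]
  rw [hset]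
  refine MeasurableSet.union (MeasurableSet.const _) (MeasurableSet.union ?_ ?_)
  · exact (measurableSet_lt_swallowingTime_of_im_pos hc (fun u hu ↦ hmeas u (hu.trans hs)) hz).compl
  · exact measurableSet_le (Complex.measurable_im.comp (measurable_centredMap_of_im_pos hc hmeas hz hs))
      measurable_const

/-- **The room stop is a stopping time** of every filtration of `ℝ≥0`-indexed σ-algebras to which
the (continuous) driving process is adapted. Rohde–Schramm (2005), proof of Lemma 6.3 (p. 905).
[cite: RohdeSchramm2005, Lemma 6.3] -/
theorem isStoppingTime_roomStop (𝓕 : Filtration ℝ≥0 mΩ) (hc : ∀ ω, Continuous (W ω))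
    (had : ∀ s : ℝ≥0, Measurable[𝓕 s] fun ω ↦ W ω s) (hz : 0 < z.im) (m : ℕ) :
    IsStoppingTime 𝓕 fun ω ↦ ((sInf ({u : ℝ≥0 | (centredMap (W ω) u z).im ≤ z.im / ((m : ℝ) + 1)} ∪
      {(m : ℝ≥0) + 1}) : ℝ≥0) : WithTop ℝ≥0) := by
  intro i
  have h := measurableSet_roomStop_le (mΩ := 𝓕 i) (t := i) hc
    (fun s hs ↦ (had s).mono (𝓕.mono hs) le_rfl) hz m le_rfl
  simpa only [WithTop.coe_le_coe] using h

/-- `ω ↦ t ∧ τ^{z,m}(ω)` is measurable (path values at times `≤ t` measurable). [folklore] -/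
theorem measurable_min_roomStop (hc : ∀ ω, Continuous (W ω))
    (hmeas : ∀ s, s ≤ t → Measurable fun ω ↦ W ω s) (hz : 0 < z.im) (m : ℕ) :
    Measurable fun ω ↦ min t (sInf ({u : ℝ≥0 | (centredMap (W ω) u z).im ≤ z.im / ((m : ℝ) + 1)} ∪
      {(m : ℝ≥0) + 1})) := by
  refine measurable_of_Iic fun x ↦ ?_
  by_cases hx : t ≤ x
  · have : (fun ω ↦ min t (sInf ({u : ℝ≥0 | (centredMap (W ω) u z).im ≤ z.im / ((m : ℝ) + 1)} ∪
        {(m : ℝ≥0) + 1}))) ⁻¹' Iic x = univ :=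
      eq_univ_of_forall fun ω ↦ (min_le_left _ _).trans hx
    rw [this]
    exact MeasurableSet.univ
  · rw [not_le] at hx
    have hx' : ¬ t ≤ x := not_le.2 hx
    have : (fun ω ↦ min t (sInf ({u : ℝ≥0 | (centredMap (W ω) u z).im ≤ z.im / ((m : ℝ) + 1)} ∪
        {(m : ℝ≥0) + 1}))) ⁻¹' Iic x =
        {ω | sInf ({u : ℝ≥0 | (centredMap (W ω) u z).im ≤ z.im / ((m : ℝ) + 1)} ∪
          {(m : ℝ≥0) + 1}) ≤ x} := by
      ext ω
      simp only [mem_preimage, mem_Iic, mem_setOf_eq, min_le_iff, hx', false_or]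
    rw [this]
    exact measurableSet_roomStop_le hc hmeas hz m hx.le

/-! ### Measurability of the flow, the observable and the ratio at the stopped time -/

/-- **Up to the room stop the flow is the truncated flow**: for every `ω`, with level
`L = Im z/(m+1)`, the truncated flow `truncFlowC t … L z ω` (horizon `t`) agrees with the
Loewner map `g_s(z)[W ω]` for real times `s ∈ [0, t ∧ τ(ω)]` (the flow has height `≥ L` there,
`div_le_im_centredMap_of_le_roomStop`, and `t ∧ τ < T_z`). [folklore] -/
theorem truncFlowC_eq_map_of_le_min_roomStop (hc : ∀ ω, Continuous (W ω)) (hz : 0 < z.im) (m : ℕ)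
    (ω : Ω) {s : ℝ} (hs0 : 0 ≤ s)
    (hs : s ≤ ((min t (sInf ({u : ℝ≥0 | (centredMap (W ω) u z).im ≤ z.im / ((m : ℝ) + 1)} ∪
      {(m : ℝ≥0) + 1})) : ℝ≥0) : ℝ)) :
    truncFlowC t hc (show (0 : ℝ) < z.im / ((m : ℝ) + 1) by positivity) z ω s =
      map (W ω) s.toNNReal z := by
  set L := z.im / ((m : ℝ) + 1) with hL
  have hLpos : 0 < L := by positivity
  set τ := sInf ({u : ℝ≥0 | (centredMap (W ω) u z).im ≤ z.im / ((m : ℝ) + 1)} ∪ {(m : ℝ≥0) + 1})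
    with hτ
  set ρ := min t τ with hρ
  have hzW : z ≠ W ω 0 := ne_driving_of_im_pos hz 0
  obtain ⟨g, hg⟩ := exists_isSolution_swallowingTime_holds (hc ω) hzW
  have hρτ : ρ ≤ τ := min_le_right _ _
  have hρT : (ρ : WithTop ℝ≥0) < swallowingTime (W ω) z :=
    coe_lt_swallowingTime_of_le_roomStop (hc ω) hz m hρτ
  -- the true flow has height `≥ L` on `[0, ρ]`
  have hfar : ∀ u ∈ Icc (0 : ℝ) ρ, L ≤ (g u).im := by
    intro u hu
    have hule : u.toNNReal ≤ ρ := by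
      rw [← NNReal.coe_le_coe, Real.coe_toNNReal _ hu.1]; exact hu.2
    have huT : ((u.toNNReal : ℝ≥0) : WithTop ℝ≥0) < swallowingTime (W ω) z :=
      lt_of_le_of_lt (WithTop.coe_le_coe.2 hule) hρT
    have h1 := div_le_im_centredMap_of_le_roomStop (hc ω) hz m (hule.trans hρτ)
    rw [centredMap_eq_of_isSolution (hc ω) hg huT, Complex.sub_im, Complex.ofReal_im, sub_zero,
      Real.coe_toNNReal _ hu.1] at h1
    exact h1
  have heq : EqOn (truncFlowC t hc hLpos z ω) g (Icc (0 : ℝ) ρ) :=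
    truncSolC_eq_of_far hLpos hg hρT hfar (truncFlowC_zero hc hLpos z ω) fun u hu ↦
      (hasDerivWithinAt_truncFlowC hc hLpos z ω ⟨hu.1, hu.2.trans (NNReal.coe_le_coe.2
        (min_le_left _ _))⟩).mono (Icc_subset_Icc le_rfl (NNReal.coe_le_coe.2 (min_le_left _ _)))
  have hsT : ((s.toNNReal : ℝ≥0) : WithTop ℝ≥0) < swallowingTime (W ω) z := by
    refine lt_of_le_of_lt (WithTop.coe_le_coe.2 ?_) hρT
    rw [← NNReal.coe_le_coe, Real.coe_toNNReal _ hs0]; exact hs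
  rw [heq ⟨hs0, hs⟩, map_eq_of_isSolution (hc ω) hg hsT, Real.coe_toNNReal _ hs0]

/-- The truncated flow is jointly measurable in `(ω, time)` (continuous in time, measurable in
`ω`: a Carathéodory function). [folklore] -/
theorem measurable_truncFlowC_uncurry (hc : ∀ ω, Continuous (W ω))
    (hmeas : ∀ s, s ≤ t → Measurable fun ω ↦ W ω s) {L : ℝ} (hL : 0 < L) (x : ℂ) :
    Measurable fun p : Ω × ℝ ↦ truncFlowC t hc hL x p.1 p.2 := by
  have h1 : Measurable (Function.uncurry fun (s : ℝ) (ω : Ω) ↦ truncFlowC t hc hL x ω s) := by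
    refine measurable_uncurry_of_continuous_of_measurable (ι := ℝ) (α := Ω) (β := ℂ)
      (u := fun (s : ℝ) (ω : Ω) ↦ truncFlowC t hc hL x ω s) ?_ ?_
    · intro ω; exact continuous_truncFlowC hc hL x ω
    · intro s; exact measurable_truncFlowC hc hmeas hL x s
  have h2 := h1.comp (measurable_swap (α := Ω) (β := ℝ))
  simpa only [Function.comp_def, Function.uncurry, Prod.fst_swap, Prod.snd_swap] using h2

/-- **The centred flow at the stopped time `t ∧ τ^{z,m}` is measurable** in `ω` (path values at
times `≤ t` measurable, continuous paths, `Im z > 0`). [folklore] -/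
theorem measurable_centredMap_min_roomStop (hc : ∀ ω, Continuous (W ω))
    (hmeas : ∀ s, s ≤ t → Measurable fun ω ↦ W ω s) (hz : 0 < z.im) (m : ℕ) :
    Measurable fun ω ↦ centredMap (W ω)
      (min t (sInf ({u : ℝ≥0 | (centredMap (W ω) u z).im ≤ z.im / ((m : ℝ) + 1)} ∪
        {(m : ℝ≥0) + 1}))) z := by
  have hLpos : (0 : ℝ) < z.im / ((m : ℝ) + 1) := by positivity
  set ρ : Ω → ℝ≥0 := fun ω ↦ min t (sInf ({u : ℝ≥0 | (centredMap (W ω) u z).im ≤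
    z.im / ((m : ℝ) + 1)} ∪ {(m : ℝ≥0) + 1})) with hρ
  have hρm : Measurable ρ := measurable_min_roomStop hc hmeas hz m
  have hpair : Measurable fun ω ↦ (ω, ((ρ ω : ℝ≥0) : ℝ)) :=
    measurable_id.prodMk (measurable_coe_nnreal_real.comp hρm)
  -- the flow part
  have hF := measurable_truncFlowC_uncurry hc hmeas hLpos z
  have hflow : Measurable fun ω ↦ truncFlowC t hc hLpos z ω (ρ ω) := by
    have h3 := hF.comp hpair
    simpa only [Function.comp_def] using h3
  -- the driver part
  have hS := measurable_stoppedPath_uncurry hc hmeas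
  have h1 : Measurable fun ω ↦ stoppedPath W t ω (((ρ ω : ℝ≥0) : ℝ).toNNReal) := by
    have h3 := hS.comp hpair
    simpa only [Function.comp_def] using h3
  have hdrv : Measurable fun ω ↦ W ω (ρ ω) := by
    have heq : (fun ω ↦ W ω (ρ ω)) = fun ω ↦ stoppedPath W t ω (((ρ ω : ℝ≥0) : ℝ).toNNReal) := by
      funext ω
      rw [Real.toNNReal_coe, stoppedPath_of_le (min_le_left _ _)]
    rw [heq]
    exact h1
  have hkey : (fun ω ↦ centredMap (W ω) (ρ ω) z) =
      fun ω ↦ truncFlowC t hc hLpos z ω (ρ ω) - W ω (ρ ω) := by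
    funext ω
    rw [centredMap_apply, truncFlowC_eq_map_of_le_min_roomStop hc hz m ω (ρ ω).coe_nonneg le_rfl,
      Real.toNNReal_coe]
  rw [hkey]
  exact hflow.sub (Complex.measurable_ofReal.comp hdrv)

/-- **Schramm's observable at the stopped time is measurable** in `ω`. [folklore] -/
theorem measurable_schrammObs_min_roomStop (hc : ∀ ω, Continuous (W ω))
    (hmeas : ∀ s, s ≤ t → Measurable fun ω ↦ W ω s) (hz : 0 < z.im) (m : ℕ) :
    Measurable fun ω ↦ schrammObs (W ω) z
      (min t (sInf ({u : ℝ≥0 | (centredMap (W ω) u z).im ≤ z.im / ((m : ℝ) + 1)} ∪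
        {(m : ℝ≥0) + 1}))) := by
  have hZ := measurable_centredMap_min_roomStop hc hmeas hz m
  unfold schrammObs
  exact ((measurable_const.add ((Complex.measurable_re.comp hZ).div hZ.norm)).div measurable_const)

/-- The rate `4 y²/|z|⁴` along the truncated flow minus the driver, as a jointly measurable
function of `(ω, time)`. [folklore] -/
theorem measurable_truncRate (hc : ∀ ω, Continuous (W ω))
    (hmeas : ∀ s, s ≤ t → Measurable fun ω ↦ W ω s) {L : ℝ} (hL : 0 < L) (x : ℂ) :
    Measurable fun p : Ω × ℝ ↦
      4 * (truncFlowC t hc hL x p.1 p.2 - stoppedPath W t p.1 p.2.toNNReal).im ^ 2 /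
        ‖truncFlowC t hc hL x p.1 p.2 - stoppedPath W t p.1 p.2.toNNReal‖ ^ 4 := by
  have hZ : Measurable fun p : Ω × ℝ ↦
      truncFlowC t hc hL x p.1 p.2 - (stoppedPath W t p.1 p.2.toNNReal : ℂ) :=
    (measurable_truncFlowC_uncurry hc hmeas hL x).sub
      (Complex.measurable_ofReal.comp (measurable_stoppedPath_uncurry hc hmeas))
  exact (measurable_const.mul ((Complex.measurable_im.comp hZ).pow_const 2)).div (hZ.norm.pow_const 4)

/-- **`log ψ` at the stopped time is measurable** in `ω`: `log ψ_{t∧τ} = ∫₀^{t∧τ} 4y²/|z|⁴`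
(Rohde–Schramm (6.3), `derivRatio_eq_exp`), the rate along `[0, t ∧ τ]` is the (jointly
measurable) rate along the truncated flow, and the integral over the random interval
`(0, t ∧ τ]` of a jointly measurable integrand is measurable
(`StronglyMeasurable.integral_prod_right`). [cite: RohdeSchramm2005, eq. (6.3)] -/
theorem measurable_log_derivRatio_min_roomStop (hc : ∀ ω, Continuous (W ω))
    (hmeas : ∀ s, s ≤ t → Measurable fun ω ↦ W ω s) (hz : 0 < z.im) (m : ℕ) :
    Measurable fun ω ↦ Real.log (derivRatio (W ω) z
      (min t (sInf ({u : ℝ≥0 | (centredMap (W ω) u z).im ≤ z.im / ((m : ℝ) + 1)} ∪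
        {(m : ℝ≥0) + 1})))) := by
  have hLpos : (0 : ℝ) < z.im / ((m : ℝ) + 1) := by positivity
  set ρ : Ω → ℝ≥0 := fun ω ↦ min t (sInf ({u : ℝ≥0 | (centredMap (W ω) u z).im ≤
    z.im / ((m : ℝ) + 1)} ∪ {(m : ℝ≥0) + 1})) with hρ
  have hρm : Measurable ρ := measurable_min_roomStop hc hmeas hz m
  -- the jointly measurable integrand `1_{(0, ρ ω]}(s) · rate(ω, s)`
  set R : Ω → ℝ → ℝ := fun ω s ↦
    4 * (truncFlowC t hc hLpos z ω s - stoppedPath W t ω s.toNNReal).im ^ 2 /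
      ‖truncFlowC t hc hLpos z ω s - stoppedPath W t ω s.toNNReal‖ ^ 4 with hR
  have hRm : Measurable (Function.uncurry R) := measurable_truncRate hc hmeas hLpos z
  set F : Ω → ℝ → ℝ := fun ω s ↦ if s ∈ Ioc (0 : ℝ) (ρ ω) then R ω s else 0 with hF
  have hEm : MeasurableSet {p : Ω × ℝ | p.2 ∈ Ioc (0 : ℝ) (ρ p.1)} := by
    have h1 : {p : Ω × ℝ | p.2 ∈ Ioc (0 : ℝ) (ρ p.1)} = {p | 0 < p.2} ∩ {p | p.2 ≤ (ρ p.1 : ℝ)} := by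
      ext p; simp only [mem_setOf_eq, mem_Ioc, mem_inter_iff]
    rw [h1]
    exact (measurableSet_lt measurable_const measurable_snd).inter
      (measurableSet_le measurable_snd ((measurable_coe_nnreal_real.comp hρm).comp measurable_fst))
  have hFm : Measurable (Function.uncurry F) := by
    have : Function.uncurry F = fun p : Ω × ℝ ↦ if p ∈ {p : Ω × ℝ | p.2 ∈ Ioc (0 : ℝ) (ρ p.1)}
        then Function.uncurry R p else 0 := by
      funext p; rfl
    rw [this]
    exact Measurable.ite hEm hRm measurable_const
  have hint : Measurable fun ω ↦ ∫ s, F ω s := (hFm.stronglyMeasurable.integral_prod_right).measurable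
  -- identification with `log ψ_{ρ}`
  have hfun : (fun ω ↦ Real.log (derivRatio (W ω) z (ρ ω))) = fun ω ↦ ∫ s, F ω s := by
    funext ω
    have hρT : (ρ ω : WithTop ℝ≥0) < swallowingTime (W ω) z :=
      coe_lt_swallowingTime_of_le_roomStop (hc ω) hz m (min_le_right _ _)
    rw [derivRatio_eq_exp (hc ω) hz hρT, Real.log_exp,
      intervalIntegral.integral_of_le (ρ ω).coe_nonneg, ← integral_indicator measurableSet_Ioc]
    refine integral_congr_ae (ae_of_all _ fun s ↦ ?_)
    by_cases hs : s ∈ Ioc (0 : ℝ) ((ρ ω : ℝ≥0) : ℝ)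
    · have hle : s.toNNReal ≤ t := by
        rw [← NNReal.coe_le_coe, Real.coe_toNNReal _ hs.1.le]
        exact hs.2.trans (NNReal.coe_le_coe.2 (min_le_left _ _))
      rw [indicator_of_mem hs]
      simp only [hF, hR]
      rw [if_pos hs, derivRatioRate_apply, truncFlowC_eq_map_of_le_min_roomStop hc hz m ω hs.1.le hs.2,
        stoppedPath_of_le hle]
    · rw [indicator_of_notMem hs]
      simp only [hF]
      rw [if_neg hs]
  rw [hfun]
  exact hint

/-- **The stopped room–entropy combination is measurable in `ω`**: for continuous driving paths
whose values at times `≤ t` are `𝓜`-measurable and `Im z > 0`,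
`ω ↦ log ψ_{t∧τ}(z)[W ω] + 3 H(S_{t∧τ}(z)[W ω])` (`τ = τ^{z,m}` the room stop) is
`𝓜`-measurable. [folklore] -/
theorem measurable_roomObs_min_roomStop (hc : ∀ ω, Continuous (W ω))
    (hmeas : ∀ s, s ≤ t → Measurable fun ω ↦ W ω s) (hz : 0 < z.im) (m : ℕ) :
    Measurable fun ω ↦
      Real.log (derivRatio (W ω) z
        (min t (sInf ({u : ℝ≥0 | (centredMap (W ω) u z).im ≤ z.im / ((m : ℝ) + 1)} ∪
          {(m : ℝ≥0) + 1})))) +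
      3 * Real.binEntropy (schrammObs (W ω) z
        (min t (sInf ({u : ℝ≥0 | (centredMap (W ω) u z).im ≤ z.im / ((m : ℝ) + 1)} ∪
          {(m : ℝ≥0) + 1})))) :=
  (measurable_log_derivRatio_min_roomStop hc hmeas hz m).add
    (measurable_const.mul (Real.binEntropy_continuous.measurable.comp
      (measurable_schrammObs_min_roomStop hc hmeas hz m)))

/-- The same, as strong measurability (real values). [folklore] -/
theorem stronglyMeasurable_roomObs_min_roomStop (hc : ∀ ω, Continuous (W ω))
    (hmeas : ∀ s, s ≤ t → Measurable fun ω ↦ W ω s) (hz : 0 < z.im) (m : ℕ) :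
    StronglyMeasurable fun ω ↦
      Real.log (derivRatio (W ω) z
        (min t (sInf ({u : ℝ≥0 | (centredMap (W ω) u z).im ≤ z.im / ((m : ℝ) + 1)} ∪
          {(m : ℝ≥0) + 1})))) +
      3 * Real.binEntropy (schrammObs (W ω) z
        (min t (sInf ({u : ℝ≥0 | (centredMap (W ω) u z).im ≤ z.im / ((m : ℝ) + 1)} ∪
          {(m : ℝ≥0) + 1})))) :=
  (measurable_roomObs_min_roomStop hc hmeas hz m).stronglyMeasurable

/-- **Adaptedness of the stopped room–entropy observable**: if the continuous driving process
`W` is adapted to a filtration `𝓕` of `ℝ≥0`-indexed σ-algebras, then so is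
`t ↦ log ψ_{t∧τ}(z) + 3 H(S_{t∧τ}(z))` for every `z ∈ ℍ` and cap `m`. [folklore] -/
theorem adapted_roomObs_min_roomStop (𝓕 : Filtration ℝ≥0 mΩ) (hc : ∀ ω, Continuous (W ω))
    (had : ∀ s : ℝ≥0, Measurable[𝓕 s] fun ω ↦ W ω s) (hz : 0 < z.im) (m : ℕ) :
    Adapted 𝓕 fun t ω ↦
      Real.log (derivRatio (W ω) z
        (min t (sInf ({u : ℝ≥0 | (centredMap (W ω) u z).im ≤ z.im / ((m : ℝ) + 1)} ∪
          {(m : ℝ≥0) + 1})))) +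
      3 * Real.binEntropy (schrammObs (W ω) z
        (min t (sInf ({u : ℝ≥0 | (centredMap (W ω) u z).im ≤ z.im / ((m : ℝ) + 1)} ∪
          {(m : ℝ≥0) + 1})))) :=
  fun i ↦ measurable_roomObs_min_roomStop (mΩ := 𝓕 i) (t := i) hc
    (fun s hs ↦ (had s).mono (𝓕.mono hs) le_rfl) hz m

end Measurable

end Loewner

end Literature.Probability.RandomPlanarGeometry
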